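import Literature.AlgebraicGeometry.Morphisms.FormalModuleHomCoh
import Literature.AlgebraicGeometry.Morphisms.FormalModuleCompletionKernel
import Literature.AlgebraicGeometry.Morphisms.FormalModuleCompletionCokernel
import Literature.AlgebraicGeometry.Morphisms.FormalModuleNakayama
import Literature.AlgebraicGeometry.Morphisms.FormalModuleShift
import Literature.AlgebraicGeometry.Morphisms.FormalModuleIdealQuot
import HarnessLib

/-!
# The tricky lemma of Grothendieck's existence theorem — preparation (Steps A and B)

The Stacks Project, Tag 088A (Cohomology of Schemes, Lemma 30.27.3), in the tree's quotient model
of coherent formal modules along `V(a)` over a scheme `X` proper over a noetherian ring `A` complete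
for the `a`-adic topology (`a' = a|_X`). Given a formal tower `𝓕 = (𝓕_n)` of coherent modules, a
coherent module `H` and a morphism of towers `α : 𝓕 → H^ = (H/aⁿ⁺¹H)_n`, this file performs the two
preparatory reductions of the proof of the tricky lemma:

* **Step A** (`exists_epi_of_cokerTower_iso`): if the tower of cokernels `(coker α_n)_n` is
  algebraizable, `(coker α_n)_n ≅ C^`, then there is an EPIMORPHISM `c : H ↠ C` of coherent modules
  with `c^ = (H^ ↠ coker α ≅ C^)` — existence by full faithfulness of completion
  (`FormalModuleHomCoh.existsUnique_cmplMap_coh`, GW II Cor. 24.100), surjectivity by Nakayama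
  (`D = coker c` has `D/aD = 0`, hence `D^ = 0`, hence `D = 0` by faithfulness);
* **Step B** (`exists_lift_levelwise_epi`): with `H₁ = ker c`, the morphism `α` lifts to a
  LEVELWISE EPIMORPHISM `α̃ : 𝓕 ↠ H₁^` with `α̃ ≫ (ker c ↪ H)^ = α` — `α_n` maps onto
  `ker(H^_n → C^_n)`, these kernels form the tower `kerTower c^` whose shifted quotients are `H₁^`
  (`FormalModuleCompletionKernel`, GW II Cor. 24.90), and the shift principle
  (`FormalModuleShift`) descends `𝓕_{c₁+n} → ker → H₁^_n` to `𝓕_n`;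
* `isKilledBy_kernel_of_fac` — the kernels of `α̃_n` embed into those of `α_n` (so inherit torsion
  bounds).

Everything is proved; no named facts.

## References

* The Stacks Project, Tag 088A (Lemma 30.27.3), Tags 087W, 087X. [StacksProject]
* U. Görtz, T. Wedhorn, *Algebraic Geometry II: Cohomology of Schemes*, Springer Spektrum (2023),
  Cor. 24.90, Prop. 24.91, Cor. 24.100, Lemma 24.103 (pp. 565–570). [GortzWedhorn2023]
-/

noncomputable section

-- `TopCat.Presheaf`/`Scheme.Modules` are not reducible (as in Mathlib's `AlgebraicGeometry/Modules`).
set_option backward.isDefEq.respectTransparency false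

open CategoryTheory AlgebraicGeometry Limits TopologicalSpace Opposite
open Literature.AlgebraicGeometry.Modules

universe u

namespace Literature.AlgebraicGeometry.Morphisms

/-! ### Generalities -/

section General

variable {X : Scheme.{u}} (a : Γ(X, ⊤))

/-- If `φ ≫ ψ = χ` then `ker φ ↪ ker χ`; hence `ker φ` is killed by whatever kills `ker χ`. [folklore] -/
theorem isKilledBy_kernel_of_fac {J : X.IdealSheafData} {M N P : X.Modules} (φ : M ⟶ N) (ψ : N ⟶ P)
    (χ : M ⟶ P) (h : φ ≫ ψ = χ) (hχ : IsKilledBy J (kernel χ)) : IsKilledBy J (kernel φ) := by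
  let ι : kernel φ ⟶ kernel χ := kernel.lift χ (kernel.ι φ) (by rw [← h, kernel.condition_assoc, zero_comp])
  haveI : Mono ι := mono_of_mono_fac (kernel.lift_ι χ (kernel.ι φ) _)
  exact isKilledBy_of_mono ι hχ

/-- A coherent module with vanishing completion tower at level `0` on which `cmplMap` is faithful
is zero: used in the form "`D/aD = 0 ⇒ D = 0`". [cite: GortzWedhorn2023, Lemma 24.103, proof (p. 570)] -/
theorem isZero_of_isZero_cmplObj_zero {D : X.Modules} (h0 : IsZero (cmplObj a D 0))
    (hfaith : Function.Injective (cmplMap a : (D ⟶ D) → _)) : IsZero D := by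
  have hall : ∀ n, IsZero (cmplObj a D n) :=
    (isFormalTower_cmplTower a D).isZero_of_isZero_zero h0
  have h : cmplMap a (𝟙 D) = cmplMap a 0 := by
    refine NatTrans.ext (funext fun k => ?_)
    obtain ⟨n⟩ := k
    exact (hall n).eq_of_src _ _
  rw [IsZero.iff_id_eq_zero]
  exact hfaith h

/-- `(α_n, coker.π ≫ e)` is exact for an isomorphism `e`. [folklore] -/
theorem exact_of_cokernel_π_comp_iso {M N P : X.Modules} (φ : M ⟶ N) (e : cokernel φ ≅ P) :
    (ShortComplex.mk φ (cokernel.π φ ≫ e.hom) (by rw [cokernel.condition_assoc, zero_comp])).Exact := by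
  refine (ShortComplex.exact_iff_of_iso ?_).mp (ShortComplex.exact_cokernel φ)
  exact ShortComplex.isoMk (Iso.refl _) (Iso.refl _) e
    (by simp only [Iso.refl_hom, Category.id_comp, Category.comp_id])
    (by simp only [Iso.refl_hom, Category.id_comp])

end General

/-! ### The setting of the existence theorem -/

variable {A : Type u} [CommRing A] {X : Scheme.{u}} (f : X ⟶ Spec (.of A)) (a : A)
  {𝓕 : ℕᵒᵖ ⥤ X.Modules} (h𝓕 : IsFormalTower (algebraMapΓ f a) 𝓕)
  {H : X.Modules} (α : 𝓕 ⟶ cmplTower (algebraMapΓ f a) H)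

/-! ### Step A: algebraizing the cokernel gives an epimorphism `c : H ↠ C` -/

/-- **Step A.** If `(coker α_n)_n ≅ C^` for a coherent `C` (`X` proper over the noetherian
`a`-adically complete `A`, `H` coherent), there is an epimorphism `c : H ↠ C` with
`c^ = (H^ → coker α) ≫ ≅`. [cite: StacksProject, Tag 088A] [cite: GortzWedhorn2023, Cor. 24.100 and Lemma 24.103 (p. 570)] -/
theorem exists_epi_of_cokerTower_iso [IsNoetherianRing A] [IsProper f]
    [IsAdicComplete (Ideal.span {a}) A] (hH : Coh H) {C : X.Modules} (hC : Coh C)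
    (ε : cokerTower α ≅ cmplTower (algebraMapΓ f a) C) :
    ∃ c : H ⟶ C, Epi c ∧ cmplMap (algebraMapΓ f a) c = cokerTowerπ α ≫ ε.hom := by
  haveI : IsLocallyNoetherian X := LocallyOfFiniteType.isLocallyNoetherian f
  obtain ⟨c, hc, -⟩ := existsUnique_cmplMap_coh f a hH hC (cokerTowerπ α ≫ ε.hom)
  refine ⟨c, ?_, hc⟩
  -- `coker c = D` has `D/aD = coker(c^_0) = 0` since `c^_0 = coker.π ≫ iso` is epi
  have hD : Coh (cokernel c) := Coh.cokernel c hH hC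
  haveI : Epi (cmplMapApp (algebraMapΓ f a) c 0) := by
    have h0 : cmplMapApp (algebraMapΓ f a) c 0 = cokernel.π (α.app ⟨0⟩) ≫ ε.hom.app ⟨0⟩ := by
      rw [← cmplMap_app, hc, NatTrans.comp_app, cokerTowerπ_app]
    rw [h0]
    exact epi_comp _ _
  have hZ : IsZero (cmplObj (algebraMapΓ f a) (cokernel c) 0) :=
    IsZero.of_iso (isZero_cokernel_of_epi (cmplMapApp (algebraMapΓ f a) c 0))
      (cokernelCmplMapAppIso (algebraMapΓ f a) c 0).symm
  have hzero : IsZero (cokernel c) :=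
    isZero_of_isZero_cmplObj_zero (algebraMapΓ f a) hZ (cmplMap_injective_coh f a hD hD)
  exact Preadditive.epi_of_isZero_cokernel' _ (cokernelIsCokernel c) hzero

/-! ### Step B: lifting `α` to a levelwise epimorphism `α̃ : 𝓕 ↠ (ker c)^` -/

section StepB

variable {C : X.Modules} (c : H ⟶ C) (hαc : α ≫ cmplMap (algebraMapΓ f a) c = 0)

/-- The levelwise lift `λ_m : 𝓕_m → K_m = ker (c^_m)` of `α_m`. [folklore] -/
def liftToKerTower (m : ℕ) : 𝓕.obj ⟨m⟩ ⟶ (kerTower (cmplMap (algebraMapΓ f a) c)).obj ⟨m⟩ :=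
  kernel.lift ((cmplMap (algebraMapΓ f a) c).app ⟨m⟩) (α.app ⟨m⟩) (by
    rw [← NatTrans.comp_app, hαc, NatTrans.app_zero])

/-- `λ_m ≫ (K_m ↪ H^_m) = α_m`. [folklore] -/
@[reassoc (attr := simp)]
theorem liftToKerTower_ι (m : ℕ) :
    liftToKerTower f a α c hαc m ≫ kernel.ι ((cmplMap (algebraMapΓ f a) c).app ⟨m⟩) = α.app ⟨m⟩ :=
  kernel.lift_ι _ _ _

/-- `λ` is compatible with the transition maps. [folklore] -/
@[reassoc]
theorem liftToKerTower_towerπ (m : ℕ) :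
    liftToKerTower f a α c hαc (m + 1) ≫ towerπ (kerTower (cmplMap (algebraMapΓ f a) c)) m =
      towerπ 𝓕 m ≫ liftToKerTower f a α c hαc m := by
  rw [← cancel_mono (kernel.ι ((cmplMap (algebraMapΓ f a) c).app ⟨m⟩)), Category.assoc,
    Category.assoc, liftToKerTower_ι]
  change liftToKerTower f a α c hαc (m + 1) ≫ (kerTower _).map (homOfLE (Nat.le_succ m)).op ≫ kernel.ι _ =
    towerπ 𝓕 m ≫ α.app ⟨m⟩
  rw [kerTower_map_ι, liftToKerTower_ι_assoc]
  exact (α.naturality _).symm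

set_option backward.isDefEq.respectTransparency true in
/-- **`λ_m` is an epimorphism when `(α_m, c^_m)` is exact.** [folklore] -/
theorem epi_liftToKerTower (m : ℕ)
    (hex : (ShortComplex.mk (α.app ⟨m⟩) ((cmplMap (algebraMapΓ f a) c).app ⟨m⟩)
      (by rw [← NatTrans.comp_app, hαc, NatTrans.app_zero])).Exact) :
    Epi (liftToKerTower f a α c hαc m) :=
  hex.epi_kernelLift

variable (c₁ : ℕ)

/-- The shifted maps `ψ_n = λ_{c₁+n} ≫ (K_{c₁+n} → K_{c₁+n}/aⁿ⁺¹) : 𝓕_{c₁+n} → kerShift_n`. [folklore] -/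
def trickyψ (n : ℕ) :
    𝓕.obj ⟨c₁ + n⟩ ⟶ (kerShift (algebraMapΓ f a) (cmplMap (algebraMapΓ f a) c) c₁).obj ⟨n⟩ :=
  liftToKerTower f a α c hαc (c₁ + n) ≫ kerShiftπ (algebraMapΓ f a) (cmplMap (algebraMapΓ f a) c) c₁ n

/-- Compatibility of `ψ` with the transition maps. [folklore] -/
theorem towerπ_trickyψ (n : ℕ) :
    towerπ 𝓕 (c₁ + n) ≫ trickyψ f a α c hαc c₁ n =
      trickyψ f a α c hαc c₁ (n + 1) ≫
        towerπ (kerShift (algebraMapΓ f a) (cmplMap (algebraMapΓ f a) c) c₁) n := by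
  rw [trickyψ, trickyψ, towerπ_kerShift, Category.assoc, kerShiftπ_kerShiftStep]
  exact (liftToKerTower_towerπ_assoc f a α c hαc (c₁ + n) _).symm

variable {c₁}

include h𝓕 in
/-- The descended morphism of towers `θ' : 𝓕 → kerShift c^ c₁`. [folklore] -/
def trickyLift' : 𝓕 ⟶ kerShift (algebraMapΓ f a) (cmplMap (algebraMapΓ f a) c) c₁ :=
  h𝓕.shiftDesc (kerShift (algebraMapΓ f a) (cmplMap (algebraMapΓ f a) c) c₁)
    (globalScalar_kerShift_eq_zero (algebraMapΓ f a) (cmplMap (algebraMapΓ f a) c) c₁) c₁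
    (trickyψ f a α c hαc c₁) (towerπ_trickyψ f a α c hαc c₁)

/-- Its defining property. [folklore] -/
theorem map_trickyLift'_app (n : ℕ) :
    𝓕.map (homOfLE (Nat.le_add_left n c₁)).op ≫ (trickyLift' f a h𝓕 α c hαc (c₁ := c₁)).app ⟨n⟩ =
      trickyψ f a α c hαc c₁ n :=
  h𝓕.map_shiftDesc_app _ _ _ _ _ n

/-- `θ' ≫ augmentation = α`. [folklore] -/
theorem trickyLift'_comp_kerShiftAugHom :
    trickyLift' f a h𝓕 α c hαc (c₁ := c₁) ≫ kerShiftAugHom (cmplMap (algebraMapΓ f a) c) c₁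
      (isFormalTower_cmplTower (algebraMapΓ f a) H) = α := by
  refine h𝓕.hom_ext_of_shift (cmplTower (algebraMapΓ f a) H) c₁ fun n => ?_
  rw [NatTrans.comp_app, ← Category.assoc, map_trickyLift'_app, kerShiftAugHom_app, trickyψ,
    Category.assoc, kerShiftπ_kerShiftAug, liftToKerTower_ι_assoc]
  exact (α.naturality _).symm

/-- `θ'_n` is an epimorphism when the `λ`'s are. [folklore] -/
theorem epi_trickyLift'_app (hlam : ∀ m, Epi (liftToKerTower f a α c hαc m)) (n : ℕ) :
    Epi ((trickyLift' f a h𝓕 α c hαc (c₁ := c₁)).app ⟨n⟩) := by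
  haveI : Epi (trickyψ f a α c hαc c₁ n) := by
    haveI := hlam (c₁ + n)
    exact epi_comp _ _
  exact epi_of_epi_fac (map_trickyLift'_app f a h𝓕 α c hαc (c₁ := c₁) n)

end StepB

include h𝓕 in
/-- **Step B.** For an epimorphism `c : H ↠ C` of coherent modules (`X` noetherian) with `α ≫ c^ = 0`
and `(α_n, c^_n)` exact for all `n`, the morphism `α` lifts to a levelwise epimorphism
`α̃ : 𝓕 ↠ (ker c)^` with `α̃ ≫ (ker c ↪ H)^ = α`. [cite: StacksProject, Tag 088A] [cite: GortzWedhorn2023, Cor. 24.90 and Prop. 24.91 (p. 565)] -/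
theorem exists_lift_levelwise_epi [IsLocallyNoetherian X] [CompactSpace X] (hH : Coh H)
    {C : X.Modules} (hC : Coh C) (c : H ⟶ C) [Epi c]
    (hαc : α ≫ cmplMap (algebraMapΓ f a) c = 0)
    (hex : ∀ m, (ShortComplex.mk (α.app ⟨m⟩) ((cmplMap (algebraMapΓ f a) c).app ⟨m⟩)
      (by rw [← NatTrans.comp_app, hαc, NatTrans.app_zero])).Exact) :
    ∃ αt : 𝓕 ⟶ cmplTower (algebraMapΓ f a) (kernel c),
      (∀ n, Epi (αt.app ⟨n⟩)) ∧ αt ≫ cmplMap (algebraMapΓ f a) (kernel.ι c) = α := by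
  obtain ⟨c₀, hc₀⟩ := exists_forall_iso_kerShift_cmplMap (a := algebraMapΓ f a) (w := c) hH hC
  obtain ⟨-, θ₁, hθ₁⟩ := hc₀ c₀ le_rfl
  have hlam : ∀ m, Epi (liftToKerTower f a α c hαc m) := fun m =>
    epi_liftToKerTower f a α c hαc m (hex m)
  refine ⟨trickyLift' f a h𝓕 α c hαc (c₁ := c₀) ≫ θ₁.inv, fun n => ?_, ?_⟩
  · haveI := epi_trickyLift'_app f a h𝓕 α c hαc (c₁ := c₀) hlam n
    rw [NatTrans.comp_app]
    exact epi_comp _ _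
  · rw [Category.assoc, ← hθ₁, θ₁.inv_hom_id_assoc]
    exact trickyLift'_comp_kerShiftAugHom f a h𝓕 α c hαc

end Literature.AlgebraicGeometry.Morphisms

end
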